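/-
Copyright (c) 2026 the pub-hodgecm-mathlib formalisation cell (harness21).  Prover seat hodgecm-mathlib-K2Liu-p05 (g5), Track B «K2-LIT»,
#184♮ = hLiu418 = `stmt-HodgeConjecture-24832`; #42S payer road, organ S2 (archimedean spanning), file S2-J (J2⊗-KK)
(LEAD F0P6-plan (g14) BATCH #19 (1) «J2 cut»; finding K2Liu-p05 (g5) 13:09:44Z on `K2/STATUS.md`: J2a∕J2b are ★ `K2LiuArchSectionPlace{Block,Junction,Pinned}`;
the residue is the Konno–Konno see-saw relabelling below).
-/
import Literature.NumberTheory.Weil1964.ArchUnitaryWeilHalf            -- ★ §1 `toBig_inl_one`, `junE₁∕junE₂`, `unitJunctionIdx`; `weilHomV`, `MpS.reindex`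
import Literature.RepresentationTheory.KonnoKonno2007.JunctionWeilDatumGeneralRank   -- ★ `weilRepPair_inl` (the pair's Weil representation `weilRep ∘ toBig`)
import HarnessLib

/-!
# Crux `HLiu418`, #42S organ S2, file S2-J (J2⊗-KK): FOLLAND'S NORMALISED ELEMENT IS NATURAL UNDER RELABELLING, AND THE SEE-SAW AT ONE PLACE —
# `weilElt (relabel g) = reindex (weilElt g)`, `weilHomV P_𝕎 Q_𝕎 1 ∅ (h ⊗ 1_W) = reindex (weilHomV P Q R S h)`

Cell `hodgecm-mathlib`, crux item hLiu418 = `stmt-HodgeConjecture-24832`; squad K2 ∕ K2Liu; LEAD F0P6-plan (g14); prover K2Liu-p05 (g5).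
THEOREMS ONLY (no `def`, no instance, no notation, no named-fact hypothesis, no `sorry`); lane `--supports stmt-HodgeConjecture-24832 --as helper`.
Generic in the finite index TYPES (Konno–Konno's block currency ★ `RealUnitaryDualPair`: `UForm`, `Ginf`, `toBig`, `DPIdx`; Folland's `det^{1/2}`-normalised
element ★ `UnitaryWeil.weilElt` and the junction splitting ★ `weilHomV P Q R S = weilHom ∘ toBig ∘ inl`).

WHY.  ★ `K2LiuArchSectionPlacePinned.archSectionRepJ_placeSecJ_inl_tensorPi` reads Folland's section of the WHOLE archimedean group of ONE unitary group
`U(J)` at one real place `σ` through the junction Weil representation `weilRepPair` of `U(P_σ^J, Q_σ^J) × U(1,0)` — at the BIG datum `J = 𝕋^{𝔻 ⊗ V′}` of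
socket #42S this is the junction of `U(𝕎_σ) = U(P_𝕎, Q_𝕎)` (`U(6,6)` at `n = 2`, `M₂ = 3`).  The arch organ S2 computes in the junction of the PAIR
`U(𝔻_σ) × U(V′_σ) = U(P,Q) × U(R,S)` (`U(2,2) × U(p′,q′)`), reached from the big one along `h ↦ h ⊗ 1_{V′}`; in Konno–Konno's sorted block index
`P_𝕎 = (P × R) ⊕ (Q × S)`, `Q_𝕎 = (P × S) ⊕ (Q × R)` (★ `DPIdx`) the element `h ⊗ 1_{V′}` IS `toBig P Q R S (h, 1)`.  This file proves that the two
junctions agree there, EXACTLY (no character):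
* §1 `d_relabel`, `det_d_relabel` — the `β`-block of a relabelled element is the relabelled `β`-block (same determinant).
* §2 **`weilElt_relabel`**: `weilElt (UForm.relabel e₁ e₂ g) = MpS.reindex (e₁ ⊕ e₂)⁻¹ (weilElt g)` — Folland's normalised element is NATURAL under
  relabelling of the index types (Schur at the vacuum ★ `MpS.apply_eq_vac_div_vac_smul`: same phase map by ★ `UForm.toSp_relabel` ∕ ★ `MpS.proj_reindex`,
  same vacuum coefficient `(det d)⁻¹` by ★ `vac_weilElt` ∕ ★ `MpS.vac_reindex` ∕ §1).
* §3 **`weilHomV_unit_toBig_inl` — THE SEE-SAW**: `weilHomV P_𝕎 Q_𝕎 Unit Empty (toBig P Q R S (h, 1)) = MpS.reindex (unitJunctionIdx P_𝕎 Q_𝕎)⁻¹ (weilHomV P Q R S h)`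
  (★ `toBig_inl_one`: `(h ⊗ 1_W) ⊗ 1₁` is the relabelling of `h ⊗ 1_W`; §2); operator form `weilHomV_unit_toBig_inl_apply`, and in `weilRepPair` letters
  **`weilRepPair_unit_toBig_inl`**: `(weilRep ∘ toBig P_𝕎 Q_𝕎 1 ∅) (toBig P Q R S (h,1), 1) f = e_* ((weilRep ∘ toBig P Q R S) (h, 1) (e_*⁻¹ f))`,
  `e = reindexCLE (unitJunctionIdx P_𝕎 Q_𝕎)⁻¹`.
So every junction-currency statement of the S2 organ about `weilRepPair (h, 1)` for `U(2,2) × U(p′,q′)` (★ `K2LiuArchWeilFockDerivatives`, ★ `K2LiuWeilDatum*U22`)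
transfers VERBATIM to the first factor of `U(𝕎_σ) × U(1,0)` restricted along `h ↦ h ⊗ 1`, i.e. to ★ `archSectionRepJ_placeSecJ_inl_tensorPi` at the big datum; the
remaining J2 steps are the group-level identity `tensorEmb (placeSec_𝔻 σ h) = placeSec_𝕎 σ (toBig (h̃, 1))` in the sign frames (J2⊗-arch, K2E5-p16's J0 bijection) and
the composition with ★ `exists_clm_swSection_tmul_mul_archEmb_placeSecJ` (J2c).
References: [KonnoKonno2007] §3.1 (3.1), §3.3 p. 47; [Folland1989] §1.3 (1.25), §4.2 (4.23), (4.36), Prop. (4.39); [Weil1964] Chap. I n° 12 p. 160;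
[Kudla1984] §1 (see-saw pairs); [Paul1998] §1.2 (1.2.1)–(1.2.2); [MoeglinVignerasWaldspurger1987] Ch. 1 I.17.
HONEST LABEL.  Count-neutral helper: `HC_CM` is proved only modulo the 7 printed citations (2 remaining named inputs: hLiu418 = `stmt-HodgeConjecture-24832`,
h413 = `stmt-HodgeConjecture-24833`) until rung 0 closes.
-/

set_option autoImplicit false
set_option linter.dupNamespace false -- the mandated namespace repeats `HodgeConjecture.HodgeConjecture`
set_option synthInstance.maxSize 512 -- `DecidableEq` of the nested block index `DPIdx ((P×R)⊕(Q×S)) ((P×S)⊕(Q×R)) Unit Empty` (structural, no `Classical`)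

noncomputable section

open scoped Matrix Kronecker
open Literature.RepresentationTheory.HeisenbergGroup Literature.Analysis.SegalBargmann
open Literature.NumberTheory.Weil1964 Literature.NumberTheory.Weil1964.MpS Literature.NumberTheory.Weil1964.UnitaryWeil
open Literature.NumberTheory.Weil1964.UnitaryBall
open Literature.RepresentationTheory.KonnoKonno2007 Literature.RepresentationTheory.KonnoKonno2007.RealDualPair

namespace Summit.HodgeConjecture.HodgeConjecture.Cruxes.HLiu418.K2LiuWeilSeesawRelabel

/-! ## §1 The `β`-block under relabelling -/

section Relabel

variable {α β α' β' : Type} [Fintype α] [DecidableEq α] [Fintype β] [DecidableEq β] [Fintype α'] [DecidableEq α'] [Fintype β'] [DecidableEq β']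

/-- **the `β`-block of a relabelled element**: `d (relabel e₁ e₂ g) = reindex e₂ e₂ (d g)`. [cite: MoeglinVignerasWaldspurger1987, Ch. 1 I.17] -/
theorem d_relabel (e₁ : α ≃ α') (e₂ : β ≃ β') (g : UForm α β) :
    d (UForm.relabel α β α' β' e₁ e₂ g) = Matrix.reindex e₂ e₂ (d g) := by
  ext i j
  simp only [d, mat, UForm.coe_relabel, Matrix.toBlocks₂₂, Matrix.reindex_apply, Matrix.submatrix_apply, Matrix.of_apply,
    Equiv.sumCongr_symm, Equiv.sumCongr_apply, Sum.map_inr]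

/-- hence the same determinant: `det d (relabel g) = det d g`. [cite: Folland1989, Prop. (4.39)] -/
theorem det_d_relabel (e₁ : α ≃ α') (e₂ : β ≃ β') (g : UForm α β) :
    (d (UForm.relabel α β α' β' e₁ e₂ g)).det = (d g).det := by
  rw [d_relabel, Matrix.det_reindex_self]

/-! ## §2 Folland's normalised element is natural under relabelling -/

/-- **`weilElt (relabel g) = reindex (weilElt g)`**: Folland's `det^{1/2}`-normalised element over `toSp g` transported along the permutation
`𝓢(ℝ^{α ⊕ β}) ≃ 𝓢(ℝ^{α′ ⊕ β′})` IS the normalised element over `toSp (relabel g)` — the two lie over the same symplectic map (★ `UForm.toSp_relabel`,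
★ `MpS.proj_reindex`) and have the same vacuum coefficient `(det d g)⁻¹` (★ `vac_weilElt`, ★ `MpS.vac_reindex`, §1), so Schur at the vacuum (★
`MpS.apply_eq_vac_div_vac_smul`) makes them equal. [cite: Folland1989, §1.3 (1.25), §4.2 (4.36), Prop. (4.39)] [cite: Weil1964, Chap. I n° 12 p. 160]
[cite: Paul1998, §1.2 (1.2.2)] -/
theorem weilElt_relabel (e₁ : α ≃ α') (e₂ : β ≃ β') (g : UForm α β) :
    weilElt (UForm.relabel α β α' β' e₁ e₂ g) = MpS.reindex (Equiv.sumCongr e₁ e₂).symm (weilElt g) := by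
  have hp : proj (MpS.reindex (Equiv.sumCongr e₁ e₂).symm (weilElt g)) = proj (weilElt (UForm.relabel α β α' β' e₁ e₂ g)) := by
    rw [MpS.proj_reindex, proj_weilElt, proj_weilElt, UForm.toSp_relabel]
  have hv : vac (weilElt (UForm.relabel α β α' β' e₁ e₂ g)) = vac (MpS.reindex (Equiv.sumCongr e₁ e₂).symm (weilElt g)) := by
    rw [vac_weilElt, MpS.vac_reindex, vac_weilElt, det_d_relabel]
  refine MpS.ext' hp.symm fun f => ?_
  rw [MpS.apply_eq_vac_div_vac_smul hp f, hv, div_self (vac_ne_zero _), one_smul]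

end Relabel

/-! ## §3 The see-saw at one place: `weilHomV P_𝕎 Q_𝕎 1 ∅ (h ⊗ 1_W) = reindex (weilHomV P Q R S h)` -/

section Seesaw

variable {P Q R S : Type} [Fintype P] [DecidableEq P] [Fintype Q] [DecidableEq Q] [Fintype R] [DecidableEq R] [Fintype S] [DecidableEq S]

/-- **THE SEE-SAW (element form)**: in the junction of the big group `U(𝕎) = U((P×R) ⊕ (Q×S), (P×S) ⊕ (Q×R))` with the trivial partner `U(1,0)`, the element
`h ⊗ 1_W = toBig P Q R S (h, 1)` is carried by Folland's section to the RELABELLED image of `weilHomV P Q R S h` (the junction of the pair `U(P,Q) × U(R,S)`):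
`weilHomV P_𝕎 Q_𝕎 1 ∅ (toBig P Q R S (h, 1)) = MpS.reindex (unitJunctionIdx P_𝕎 Q_𝕎)⁻¹ (weilHomV P Q R S h)` (★ `toBig_inl_one`, §2).
[cite: KonnoKonno2007, §3.1 (3.1), §3.3 p. 47] [cite: Kudla1984, §1] [cite: Folland1989, Prop. (4.39)] -/
theorem weilHomV_unit_toBig_inl (h : UForm P Q) :
    weilHomV ((P × R) ⊕ (Q × S)) ((P × S) ⊕ (Q × R)) Unit Empty (toBig P Q R S (h, 1)) =
      MpS.reindex (unitJunctionIdx ((P × R) ⊕ (Q × S)) ((P × S) ⊕ (Q × R))).symm (weilHomV P Q R S h) := by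
  rw [weilHomV_apply, weilHomV_apply, toBig_inl_one, weilElt_relabel]
  rfl

/-- **THE SEE-SAW (operator form)**: `(weilHomV P_𝕎 Q_𝕎 1 ∅ (h ⊗ 1_W)) (e_* f) = e_* ((weilHomV P Q R S h) f)`, `e = reindexCLE (unitJunctionIdx P_𝕎 Q_𝕎)⁻¹`
(★ `MpS.reindex_apply_schwartzTransport`). [cite: KonnoKonno2007, §3.3 p. 47] [cite: Folland1989, §1.3 (1.25)] -/
theorem weilHomV_unit_toBig_inl_apply (h : UForm P Q) (f : SchwartzMap (DPIdx P Q R S → ℝ) ℂ) :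
    (weilHomV ((P × R) ⊕ (Q × S)) ((P × S) ⊕ (Q × R)) Unit Empty (toBig P Q R S (h, 1))).1.2
        (schwartzTransport (reindexCLE (unitJunctionIdx ((P × R) ⊕ (Q × S)) ((P × S) ⊕ (Q × R))).symm) f) =
      schwartzTransport (reindexCLE (unitJunctionIdx ((P × R) ⊕ (Q × S)) ((P × S) ⊕ (Q × R))).symm) ((weilHomV P Q R S h).1.2 f) := by
  rw [weilHomV_unit_toBig_inl, MpS.reindex_apply_schwartzTransport]

/-- **THE SEE-SAW in `weilRepPair` letters** (★ `weilRepPair = weilRep ∘ toBig`, ★ `weilRepPair_inl` is `rfl`): the hypothesis-free junction Weil representation of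
`U(𝕎) × U(1,0)` at `(h ⊗ 1_W, 1)` on a relabelled vector is the relabelled image of the junction Weil representation of `U(P,Q) × U(R,S)` at `(h, 1)`.
[cite: KonnoKonno2007, §3.3 p. 47] [cite: Kudla1984, §1] -/
theorem weilRepPair_unit_toBig_inl (h : UForm P Q) (f : SchwartzMap (DPIdx P Q R S → ℝ) ℂ) :
    (weilRep (α := (((P × R) ⊕ (Q × S)) × Unit) ⊕ (((P × S) ⊕ (Q × R)) × Empty))
          (β := (((P × R) ⊕ (Q × S)) × Empty) ⊕ (((P × S) ⊕ (Q × R)) × Unit))).comp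
        (toBig ((P × R) ⊕ (Q × S)) ((P × S) ⊕ (Q × R)) Unit Empty)
        ((toBig P Q R S (h, 1), (1 : UForm Unit Empty)) : Ginf ((P × R) ⊕ (Q × S)) ((P × S) ⊕ (Q × R)) Unit Empty)
        (schwartzTransport (reindexCLE (unitJunctionIdx ((P × R) ⊕ (Q × S)) ((P × S) ⊕ (Q × R))).symm) f) =
      schwartzTransport (reindexCLE (unitJunctionIdx ((P × R) ⊕ (Q × S)) ((P × S) ⊕ (Q × R))).symm)
        ((weilRep (α := (P × R) ⊕ (Q × S)) (β := (P × S) ⊕ (Q × R))).comp (toBig P Q R S) ((h, (1 : UForm R S)) : Ginf P Q R S) f) := by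
  rw [weilRepPair_inl, weilRepPair_inl]
  exact weilHomV_unit_toBig_inl_apply h f

end Seesaw

end Summit.HodgeConjecture.HodgeConjecture.Cruxes.HLiu418.K2LiuWeilSeesawRelabel

end
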